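import Mathlib
import Literature.Analysis.FluidPDE.VectorCalculus
import Summits.NavierStokesRegularity.NavierStokesRegularity.Theorems.UnthreadedDoorFluxStarvedDipolePoleIdentity
import Summits.NavierStokesRegularity.NavierStokesRegularity.Theorems.UnthreadedDoorFluxStarvedDipoleAmplitudeInequality
import Summits.NavierStokesRegularity.NavierStokesRegularity.Theorems.UnthreadedDoorFluxStarvedDipoleConvexEndgame
import HarnessLib

/-!
# Route `UnthreadedDoor`, crux `PoloidalLiouville` (stmt-NavierStokesRegularity-1222), wall W1 — crux idea
# «flux-starved-dipoles» (ns-idea-15 g12/g13, `Cruxes/PoloidalLiouville/FluxStarvedDipoleSketch.lean`):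
# `FluxStarvationSteady → AmplitudeLawSteady`, hence K1 `DipoleNeverSteady ⟸ FluxStarvationSteady` (kernel)

The sketch composes K1 as `dipoleNeverSteady_of : AmplitudeLawSteady → ConvexEndgame → DipoleNeverSteady`, both antecedents
paper-proved.  With `ConvexEndgame` (p836018), the ODE half `amplitude_law_of_poleIdentity` (p836154) and the PDE half
`poleIdentity_of_shellTangent` (`…FluxStarvedDipolePoleIdentity`) in the tree, THIS FILE closes the bookkeeping of the card's
§Proof step 4 and reduces K1 to the single typed Prop `FluxStarvationSteady` (the lever (★): zero net flux through spheres +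
latitude-circle averaging ⇒ the drift is tangent to every NON-SOLID dipolar sphere):

* `amplitude_law_of_solid` — the SOLID-RADII case (K1-b of the hands' census): if `s·(‖A‖)′(s) = ‖A(s)‖` for all `s` near
  `r` (locally `‖A‖ = C·s`, Hill-type core), then `w = s‖A s‖` satisfies `w″(r) = 2w(r)/r²` — the amplitude inequality with
  equality, no PDE input;
* `amplitudeLawSteady_of_fluxStarvationSteady` — `FluxStarvationSteady → AmplitudeLawSteady` (both Props VERBATIM, unfolded:
  `dipolePotential`, `amplitude`, `IsNonSolidAt`, `SteadyKinematicLawOn` are spelled out).  At `r` with `A(r) ≠ 0`: either `r`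
  is eventually solid (previous bullet), or non-solid radii accumulate at `r`; at each non-solid `s` the non-solid set is open,
  flux starvation gives tangency on a shell, `poleIdentity_of_shellTangent` gives `ℓ(s) = 0`, continuity of
  `ℓ(s) = ⟪A″ + (2/s)A′ − (2/s²)A, A⟫(s)` gives `ℓ(r) = 0`, and the ODE half concludes;
* `dipoleNeverSteady_of_fluxStarvationSteady` — `FluxStarvationSteady → DipoleNeverSteady` (K1 VERBATIM, unfolded), by the
  sketch's glue with `convexEndgame`.

So of the crux card's K1 only `FluxStarvationSteady` [XL: Gauss/Stokes on spheres is not in Mathlib] remains unproved in the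
kernel.  HONEST LABEL: linear kinematic shadow of W1 (critic V28: information-grade, W1 movement 0); `FluxStarvationSteady`, K1
as an unconditional fact, `PoloidalLiouville` (1222), its wall `stub_scalarLiouville` and the summit stay OPEN; NO Navier–Stokes
regularity statement is proved.  `--supports stmt-NavierStokesRegularity-1222` (helper).  [folklore]
-/

noncomputable section

-- the summit and its single sub-problem share the name (CONVENTIONS §1)
set_option linter.dupNamespace false

open Set Filter Topology InnerProductSpace
open scoped RealInnerProductSpace Laplacian
open Literature.Analysis.FluidPDE

namespace Summit.NavierStokesRegularity.NavierStokesRegularity.Theorems.PoloidalLiouville.FluxStarvedDipole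

variable {F : Type*} [NormedAddCommGroup F] [InnerProductSpace ℝ F]

/-! ### The solid-radii case -/

/-- **SOLID RADII** (K1-b).  If `A` is `C²` at `r > 0`, `A r ≠ 0`, and `s·(‖A‖)′(s) = ‖A s‖` for all `s` near `r`, then
`w(s) = s‖A s‖` is `C²` at `r` with `2w(r)/r² ≤ w″(r)` (indeed equality: `w′ = 2‖A‖` near `r` and `r·(‖A‖)″(r) = 0`). [folklore] -/
theorem amplitude_law_of_solid (A : ℝ → F) {r : ℝ} (hr : 0 < r) (hA : ContDiffAt ℝ 2 A r) (hA0 : A r ≠ 0)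
    (hsolid : ∀ᶠ s in 𝓝 r, s * deriv (fun t => ‖A t‖) s = ‖A s‖) :
    ContDiffAt ℝ 2 (fun s => s * ‖A s‖) r ∧
      2 * (r * ‖A r‖) / r ^ 2 ≤ iteratedDeriv 2 (fun s => s * ‖A s‖) r := by
  set a : ℝ → ℝ := fun t => ‖A t‖ with ha_def
  have ha : ContDiffAt ℝ 2 a r := hA.norm ℝ hA0
  refine ⟨contDiffAt_id.mul ha, ?_⟩
  -- `a` is differentiable near `r`, `a′` is differentiable at `r`
  have hev : ∀ᶠ s in 𝓝 r, ContDiffAt ℝ 2 a s := ha.eventually (by simp)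
  have hda : HasDerivAt (deriv a) (iteratedDeriv 2 a r) r := convexEndgame_hasDerivAt_deriv ha
  -- differentiate the solid identity at `r`: `a′(r) + r a″(r) = a′(r)`
  have hlhs : HasDerivAt (fun s => s * deriv a s) (1 * deriv a r + r * iteratedDeriv 2 a r) r :=
    (hasDerivAt_id' r).mul hda
  have hid : deriv (fun s => s * deriv a s) r = deriv a r := Filter.EventuallyEq.deriv_eq hsolid
  rw [hlhs.deriv] at hid
  have ha2 : iteratedDeriv 2 a r = 0 := by
    have h : r * iteratedDeriv 2 a r = 0 := by linarith
    rcases mul_eq_zero.mp h with h | h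
    · exact absurd h hr.ne'
    · exact h
  -- the derivatives of `w`
  have hW : ∀ᶠ s in 𝓝 r, HasDerivAt (fun x => x * a x) (1 * a s + s * deriv a s) s := by
    filter_upwards [hev] with s hs
    exact (hasDerivAt_id' s).mul (hs.differentiableAt (by norm_num)).hasDerivAt
  have hderivW : deriv (fun x => x * a x) =ᶠ[𝓝 r] fun s => 1 * a s + s * deriv a s :=
    hW.mono fun s hs => hs.deriv
  have had : HasDerivAt a (deriv a r) r := (ha.differentiableAt (by norm_num)).hasDerivAt
  have h2 : HasDerivAt (fun s => 1 * a s + s * deriv a s) (1 * deriv a r + (1 * deriv a r + r * iteratedDeriv 2 a r)) r :=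
    (had.const_mul 1).add hlhs
  have h2nd : iteratedDeriv 2 (fun x => x * a x) r = 1 * deriv a r + (1 * deriv a r + r * iteratedDeriv 2 a r) := by
    rw [iteratedDeriv_succ, iteratedDeriv_one, hderivW.deriv_eq]
    exact h2.deriv
  have hsr : r * deriv a r = a r := hsolid.self_of_nhds
  have hw : (fun s => s * ‖A s‖) = fun x => x * a x := rfl
  rw [hw, h2nd, ha2]
  have : 2 * (r * a r) / r ^ 2 = 2 * deriv a r := by
    rw [← hsr]; field_simp
  rw [show (2 : ℝ) * (r * ‖A r‖) / r ^ 2 = 2 * (r * a r) / r ^ 2 from rfl, this]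
  linarith

/-! ### `FluxStarvationSteady → AmplitudeLawSteady` -/

/-- Continuity of the pole defect `ℓ(s) = ⟪A″(s) + (2/s)A′(s) − (2/s²)A(s), A(s)⟫` on `(0,∞)` for `A ∈ C³(0,∞)`. [folklore] -/
theorem continuousAt_poleDefect {A : ℝ → F} (hA : ContDiffOn ℝ 3 A (Set.Ioi 0)) {r : ℝ} (hr : 0 < r) :
    ContinuousAt (fun s => ⟪iteratedDeriv 2 A s + (2 / s) • deriv A s - (2 / s ^ 2) • A s, A s⟫) r := by
  have hmem : Set.Ioi (0 : ℝ) ∈ 𝓝 r := Ioi_mem_nhds hr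
  have hA0 : ContinuousAt A r := (hA.continuousOn.continuousAt hmem)
  have hA1 : ContinuousAt (deriv A) r :=
    (hA.continuousOn_deriv_of_isOpen isOpen_Ioi (by norm_num)).continuousAt hmem
  have hA2 : ContinuousAt (iteratedDeriv 2 A) r := by
    have h1 : ContDiffOn ℝ 2 (deriv A) (Set.Ioi 0) := hA.deriv_of_isOpen isOpen_Ioi (by norm_num)
    have h2 : ContinuousOn (deriv (deriv A)) (Set.Ioi 0) := h1.continuousOn_deriv_of_isOpen isOpen_Ioi (by norm_num)
    have hfun : iteratedDeriv 2 A = deriv (deriv A) := by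
      rw [iteratedDeriv_succ, iteratedDeriv_one]
    rw [hfun]
    exact h2.continuousAt hmem
  have hs1 : ContinuousAt (fun s : ℝ => 2 / s) r := continuousAt_const.div continuousAt_id hr.ne'
  have hs2 : ContinuousAt (fun s : ℝ => 2 / s ^ 2) r :=
    continuousAt_const.div (continuousAt_id.pow 2) (pow_ne_zero 2 hr.ne')
  exact ((hA2.add (hs1.smul hA1)).sub (hs2.smul hA0)).inner hA0

/-- **`FluxStarvationSteady → AmplitudeLawSteady`** (both sketch Props VERBATIM, with `dipolePotential`, `amplitude`,
`IsNonSolidAt`, `SteadyKinematicLawOn` unfolded).  Flux starvation = the drift is tangent to every non-solid dipolar sphere;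
conclusion = the amplitude `w = r‖A‖` is `C²` with `w″ ≥ 2w/r²` wherever `A ≠ 0`.  Trichotomy at `r`: eventually solid
(`amplitude_law_of_solid`); otherwise non-solid radii accumulate at `r`, each carries an open shell of tangency, hence the pole
identity (`poleIdentity_of_shellTangent`), which passes to `r` by continuity and feeds the ODE half
(`amplitude_law_of_poleIdentity`, p836154). [folklore] -/
theorem amplitudeLawSteady_of_fluxStarvationSteady
    (hF : ∀ (u : EuclideanSpace ℝ (Fin 3) → EuclideanSpace ℝ (Fin 3)) (x₀ : EuclideanSpace ℝ (Fin 3))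
        (A : ℝ → EuclideanSpace ℝ (Fin 3)) (R : ℝ → ℝ),
      ContDiff ℝ 1 u → Literature.Analysis.FluidPDE.VectorCalculus.IsDivFree u →
      ContDiffOn ℝ 3 A (Set.Ioi 0) → ContDiffOn ℝ 3 R (Set.Ioi 0) →
      (∀ x ∈ ({x₀}ᶜ : Set (EuclideanSpace ℝ (Fin 3))),
        cross (gradient (fun z => ⟪u z, gradient (fun x => ⟪A ‖x - x₀‖, x - x₀⟫ / ‖x - x₀‖ + R ‖x - x₀‖) z⟫
            - Δ (fun x => ⟪A ‖x - x₀‖, x - x₀⟫ / ‖x - x₀‖ + R ‖x - x₀‖) z) x) (x - x₀)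
          = cross (gradient (fun z => ⟪u z, z - x₀⟫) x)
              (gradient (fun x => ⟪A ‖x - x₀‖, x - x₀⟫ / ‖x - x₀‖ + R ‖x - x₀‖) x)) →
      ∀ r > 0, (A r ≠ 0 ∧ r * deriv (fun s => ‖A s‖) r ≠ ‖A r‖) →
        ∀ x, ‖x - x₀‖ = r → ⟪u x, x - x₀⟫ = 0) :
    ∀ (u : EuclideanSpace ℝ (Fin 3) → EuclideanSpace ℝ (Fin 3)) (x₀ : EuclideanSpace ℝ (Fin 3))
        (A : ℝ → EuclideanSpace ℝ (Fin 3)) (R : ℝ → ℝ),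
      ContDiff ℝ 1 u → Literature.Analysis.FluidPDE.VectorCalculus.IsDivFree u →
      ContDiffOn ℝ 3 A (Set.Ioi 0) → ContDiffOn ℝ 3 R (Set.Ioi 0) →
      (∀ x ∈ ({x₀}ᶜ : Set (EuclideanSpace ℝ (Fin 3))),
        cross (gradient (fun z => ⟪u z, gradient (fun x => ⟪A ‖x - x₀‖, x - x₀⟫ / ‖x - x₀‖ + R ‖x - x₀‖) z⟫
            - Δ (fun x => ⟪A ‖x - x₀‖, x - x₀⟫ / ‖x - x₀‖ + R ‖x - x₀‖) z) x) (x - x₀)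
          = cross (gradient (fun z => ⟪u z, z - x₀⟫) x)
              (gradient (fun x => ⟪A ‖x - x₀‖, x - x₀⟫ / ‖x - x₀‖ + R ‖x - x₀‖) x)) →
      ∀ r > 0, A r ≠ 0 →
        ContDiffAt ℝ 2 (fun r => r * ‖A r‖) r ∧
          2 * (r * ‖A r‖) / r ^ 2 ≤ iteratedDeriv 2 (fun r => r * ‖A r‖) r := by
  intro u x₀ A R hu hdiv hA hR hlaw r hr hAr
  have hA2 : ContDiffAt ℝ 2 A r := (hA.of_le (by norm_num)).contDiffAt (Ioi_mem_nhds hr)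
  by_cases hsol : ∀ᶠ s in 𝓝 r, s * deriv (fun t => ‖A t‖) s = ‖A s‖
  · exact amplitude_law_of_solid A hr hA2 hAr hsol
  -- non-solid radii accumulate at `r`
  have hfreq : ∃ᶠ s in 𝓝 r, ¬ (s * deriv (fun t => ‖A t‖) s = ‖A s‖) := Filter.not_eventually.mp hsol
  -- the open set `V = (0,∞) ∩ {A ≠ 0}` on which `a = ‖A‖` is `C³`, and the non-solidity defect `φ = s a′ − a`
  set V : Set ℝ := Set.Ioi 0 ∩ A ⁻¹' ({0}ᶜ : Set (EuclideanSpace ℝ (Fin 3))) with hV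
  have hVo : IsOpen V := hA.continuousOn.isOpen_inter_preimage isOpen_Ioi isOpen_compl_singleton
  have hrV : r ∈ V := ⟨hr, hAr⟩
  have haV : ContDiffOn ℝ 3 (fun t => ‖A t‖) V := (hA.mono Set.inter_subset_left).norm ℝ fun t ht => ht.2
  have hφ : ContinuousOn (fun t => t * deriv (fun t => ‖A t‖) t - ‖A t‖) V :=
    (continuousOn_id.mul (haV.continuousOn_deriv_of_isOpen hVo (by norm_num))).sub haV.continuousOn
  -- at every non-solid `s ∈ V` the pole identity holds
  have hpole : ∀ᶠ s in 𝓝 r, ¬ (s * deriv (fun t => ‖A t‖) s = ‖A s‖) →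
      ⟪iteratedDeriv 2 A s + (2 / s) • deriv A s - (2 / s ^ 2) • A s, A s⟫ = 0 := by
    filter_upwards [hVo.mem_nhds hrV] with s hsV hns
    -- the non-solid set is open: tangency on a shell of radii around `s`
    have hφs : ContinuousAt (fun t => t * deriv (fun t => ‖A t‖) t - ‖A t‖) s := hφ.continuousAt (hVo.mem_nhds hsV)
    have hne : (fun t => t * deriv (fun t => ‖A t‖) t - ‖A t‖) s ≠ 0 := fun h => hns (sub_eq_zero.mp h)
    have htan : ∀ᶠ t in 𝓝 s, ∀ x, ‖x - x₀‖ = t → ⟪u x, x - x₀⟫ = 0 := by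
      filter_upwards [hφs.eventually_ne hne, hVo.mem_nhds hsV] with t ht htV
      exact hF u x₀ A R hu hdiv hA hR hlaw t htV.1 ⟨htV.2, fun h => ht (sub_eq_zero.mpr h)⟩
    exact poleIdentity_of_shellTangent u x₀ A R hu hA hR hlaw hsV.1 hsV.2 htan
  -- continuity carries the pole identity to `r`
  have hℓ : ⟪iteratedDeriv 2 A r + (2 / r) • deriv A r - (2 / r ^ 2) • A r, A r⟫ = 0 := by
    by_contra hne
    have hev := (continuousAt_poleDefect hA hr).eventually_ne hne
    have h := hfreq.and_eventually (hpole.and hev)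
    exact Filter.frequently_false (𝓝 r) (h.mono fun s hs => hs.2.2 (hs.2.1 hs.1))
  exact amplitude_law_of_poleIdentity A hr hA2 hAr hℓ

/-! ### K1 from flux starvation alone -/

/-- **K1 ⟸ FLUX STARVATION**: `FluxStarvationSteady → DipoleNeverSteady` (both sketch Props VERBATIM, unfolded) — no steady
toroidal dipole `B = A(r) × ξ` with `‖A‖ ≤ C`, `A, R ∈ C³(0,∞)`, is maintained on `ℝ³` by a `C¹` incompressible drift obeying the
steady kinematic law off the centre, PROVIDED flux starvation holds.  Kernel composition of
`amplitudeLawSteady_of_fluxStarvationSteady` with `convexEndgame` (p836018) along the sketch's glue `dipoleNeverSteady_of`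
(`w = r‖A‖ ≥ 0` is continuous, `w ≤ C r`).  K1 itself stays conditional on `FluxStarvationSteady`. [folklore] -/
theorem dipoleNeverSteady_of_fluxStarvationSteady
    (hF : ∀ (u : EuclideanSpace ℝ (Fin 3) → EuclideanSpace ℝ (Fin 3)) (x₀ : EuclideanSpace ℝ (Fin 3))
        (A : ℝ → EuclideanSpace ℝ (Fin 3)) (R : ℝ → ℝ),
      ContDiff ℝ 1 u → Literature.Analysis.FluidPDE.VectorCalculus.IsDivFree u →
      ContDiffOn ℝ 3 A (Set.Ioi 0) → ContDiffOn ℝ 3 R (Set.Ioi 0) →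
      (∀ x ∈ ({x₀}ᶜ : Set (EuclideanSpace ℝ (Fin 3))),
        cross (gradient (fun z => ⟪u z, gradient (fun x => ⟪A ‖x - x₀‖, x - x₀⟫ / ‖x - x₀‖ + R ‖x - x₀‖) z⟫
            - Δ (fun x => ⟪A ‖x - x₀‖, x - x₀⟫ / ‖x - x₀‖ + R ‖x - x₀‖) z) x) (x - x₀)
          = cross (gradient (fun z => ⟪u z, z - x₀⟫) x)
              (gradient (fun x => ⟪A ‖x - x₀‖, x - x₀⟫ / ‖x - x₀‖ + R ‖x - x₀‖) x)) →
      ∀ r > 0, (A r ≠ 0 ∧ r * deriv (fun s => ‖A s‖) r ≠ ‖A r‖) →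
        ∀ x, ‖x - x₀‖ = r → ⟪u x, x - x₀⟫ = 0) :
    ∀ (u : EuclideanSpace ℝ (Fin 3) → EuclideanSpace ℝ (Fin 3)) (x₀ : EuclideanSpace ℝ (Fin 3))
        (A : ℝ → EuclideanSpace ℝ (Fin 3)) (R : ℝ → ℝ) (C : ℝ),
      ContDiff ℝ 1 u → Literature.Analysis.FluidPDE.VectorCalculus.IsDivFree u →
      ContDiffOn ℝ 3 A (Set.Ioi 0) → ContDiffOn ℝ 3 R (Set.Ioi 0) →
      (∀ r > 0, ‖A r‖ ≤ C) →
      (∀ x ∈ ({x₀}ᶜ : Set (EuclideanSpace ℝ (Fin 3))),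
        cross (gradient (fun z => ⟪u z, gradient (fun x => ⟪A ‖x - x₀‖, x - x₀⟫ / ‖x - x₀‖ + R ‖x - x₀‖) z⟫
            - Δ (fun x => ⟪A ‖x - x₀‖, x - x₀⟫ / ‖x - x₀‖ + R ‖x - x₀‖) z) x) (x - x₀)
          = cross (gradient (fun z => ⟪u z, z - x₀⟫) x)
              (gradient (fun x => ⟪A ‖x - x₀‖, x - x₀⟫ / ‖x - x₀‖ + R ‖x - x₀‖) x)) →
      ∀ r > 0, A r = 0 := by
  intro u x₀ A R C hu hdiv hA hR hC hlaw r hr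
  have h₁ := amplitudeLawSteady_of_fluxStarvationSteady hF u x₀ A R hu hdiv hA hR hlaw
  have hw : ∀ s > 0, s * ‖A s‖ = 0 := by
    refine convexEndgame (fun s => s * ‖A s‖) C ?_ ?_ ?_ ?_
    · have hAn : ContinuousOn (fun s => ‖A s‖) (Set.Ioi 0) := hA.continuousOn.norm
      exact continuousOn_id.mul hAn
    · intro s hs
      exact mul_nonneg hs.le (norm_nonneg _)
    · intro s hs
      calc s * ‖A s‖ ≤ s * C := mul_le_mul_of_nonneg_left (hC s hs) hs.le
        _ = C * s := mul_comm _ _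
    · intro s hs hpos
      have hAs : A s ≠ 0 := by
        intro h0
        rw [h0, norm_zero, mul_zero] at hpos
        exact lt_irrefl _ hpos
      exact h₁ s hs hAs
  have h0 : r * ‖A r‖ = 0 := hw r hr
  rcases mul_eq_zero.mp h0 with h | h
  · exact absurd h hr.ne'
  · exact norm_eq_zero.mp h

end Summit.NavierStokesRegularity.NavierStokesRegularity.Theorems.PoloidalLiouville.FluxStarvedDipole

end
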